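/-
Copyright (c) 2026 the pub-hodgecm-mathlib formalisation cell (harness21).  Prover seat hodgecm-mathlib-K2E4-p10 (g4), Track B ∕ K2-LIT, h413 =
`stmt-HodgeConjecture-24833`, line `K2_E1_TraceFormulaBeta`, campaign «EIS-RANK-ONE», queue item (q11) «Kc-UNIFORM ARCH» of the dealer K2E1-plan (g4) 2026-09-04T07:14:46Z:
the centre-layer archimedean binder `hφarch` of the spherical flat section of `U(2,1)` with ONE constant `C_φ` for ALL `z` in a ball `‖z‖ ≤ R` (★ (a3)₃ p858136 hoisted).
-/
import Summits.HodgeConjecture.HodgeConjecture.Theorems.K2E1HeightLineArchSmoothU3   -- ★ (a3)₃ p858136 (K2E1-p08 g5): per-`z` version, §1 explicit tensor Leibniz, §2 the closed form along the line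
import Summits.HodgeConjecture.HodgeConjecture.Theorems.K2E1SymbolFaaDiBruno         -- ★ (E-a) p858171 (K2E1-p08 g5): `norm_iteratedFDeriv_cpow_neg_le_of_symbol` — constant EXPLICIT and monotone in `‖w‖`
import HarnessLib

/-!
# K2·E1 — `K2E1HeightLineArchSmoothUniformU3` ((q11) «Kc-UNIFORM ARCH»): `hφarch` FOR THE SPHERICAL FLAT SECTION OF `U(2,1)` WITH ONE `C_φ` ON `‖z‖ ≤ R`
# (campaign «EIS-RANK-ONE»: the last named input of U3b∕(R3u)₃ besides `hφarchZ` — ★ (a3)₃ `exists_archSmooth_flatSectionU_const_cm_three` with `∃ C_φ` HOISTED before `z`)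

Track B ∕ K2-LIT, crux h413 = `stmt-HodgeConjecture-24833`, route of record `HCCMUnconditional`; cell `hodgecm-mathlib`, squad K2, ENGINE E1.  Prover seat
`hodgecm-mathlib-K2E4-p10` (g4); queue item (q11) of the dealer K2E1-plan (g4) 2026-09-04T07:14:46Z.  THEOREMS ONLY (no `def`, no `instance`, no notation, no named-fact hypothesis,
no `sorry`); lane `--supports stmt-HodgeConjecture-24833 --as helper` (count-neutral).  Closes no socket.

THE MATHEMATICS [HormanderALPDO1, §7.1; MoeglinWaldspurger1995, I.2.10–I.2.12, II.1.5; Garrett2018, §2.2, §12.2].  ★ (a3)₃'s constant depends on `z` only through the per-place input ★ (a1ᵘ)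
`exists_norm_iteratedDeriv_affine_le_uniform` (a `∃ C` per `z`).  We replace it by the POWER-OF-A-SYMBOL estimate ★ (E-a) `norm_iteratedFDeriv_cpow_neg_le_of_symbol`, whose constant
`Σ_{c : OrderedFinpartition n} (∏_{l<|c|}(‖z‖ + l))·K^{|c|}` is EXPLICIT and MONOTONE in `‖z‖`: §1 for the affine symbol `f(s) = A + c s²` (`A ≥ 1`, `0 < c ≤ c₀`) the derivative bounds
`‖f′‖ = 2c|s| ≤ √c·(1 + cs²) ≤ √c₀·f` (AM–GM), `‖f″‖ = 2c ≤ 2c₀·f`, `f⁽ⁱ⁾ = 0` (`i ≥ 3`) give `‖Dⁱf‖ ≤ K·f` with `K = √c₀ + 2c₀` (`norm_iteratedFDeriv_affine_le_mul`); §2 hence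
`‖Dⁿ[(A + cs²)^{−z}](s)‖ ≤ C_R·(A + cs²)^{−Re z}` for ALL `‖z‖ ≤ R`, `A ≥ 1`, `0 < c ≤ c₀`, `s` with `C_R = Σ_c (∏(R + l))·K^{|c|}` (`exists_norm_iteratedDeriv_affine_le_uniform_of_norm_le`);
§3 re-runs ★ (a3)₃ §3's tensor assembly verbatim (★ `norm_iteratedFDeriv_finset_prod_le_explicit`, the constant factor-independent; ★ `flatSectionU_const_heisChart_line_apply_cm_three`;
★ (a3)₂ cpow bookkeeping) with the place constants now `z`-free on the ball: **`exists_archSmooth_flatSectionU_const_cm_three_uniform (hc hcδ hδ) (φ₀) (m) (R) : ∃ C_φ ≥ 0, ∀ z,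
‖z‖ ≤ R → ∀ k ∈ K_U, ∀ X b, ContDiff ℝ m (…) ∧ ∀ j ≤ m, ∀ s, ‖Dʲ(…)(s)‖ ≤ C_φ·H(ι(w₀)·u(X, θ(ι⁻¹ s, b))·k)^{Re z}`** — `hφarch` VERBATIM with ONE `C_φ` on `closedBall 0 R ⊇ Kc`
(consumers: K2E4-p11 (g4) U3b at `N = 3`; the `N = 2` twin over ★ (a3)₂ p858035 is named `…_cm_two_uniform` for the next hand).
HONEST LABEL: HC_CM is proved only modulo the 7 printed citations (2 remaining named inputs: hLiu418 = `stmt-HodgeConjecture-24832`, h413 = `stmt-HodgeConjecture-24833`) until rung 0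
closes; this file asserts no named fact and closes no socket.
References: [HormanderALPDO1] §7.1 · [MoeglinWaldspurger1995] I.2.10–I.2.12, II.1.5 · [Garrett2018] §2.2, §12.2 · [Rogawski1990] §1.10.
-/

set_option autoImplicit false
-- the mandated namespace repeats the single-problem summit's segment (`HodgeConjecture.HodgeConjecture`)
set_option linter.dupNamespace false

noncomputable section

open NumberField NumberField.InfinitePlace NumberField.mixedEmbedding IsDedekindDomain
open Literature.NumberTheory.Automorphic Literature.NumberTheory.Automorphic.UnitaryGroup AdelicGroupData
open Summit.HodgeConjecture.HodgeConjecture.Cruxes.H413.K2E1BorelEisensteinU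
open Summit.HodgeConjecture.HodgeConjecture.Cruxes.H413.K2E1HeightBigCellLineFormulaU3
open Summit.HodgeConjecture.HodgeConjecture.Cruxes.H413.K2E1OnePlusSqPowerSymbol (onePlusSq_pos)
open Summit.HodgeConjecture.HodgeConjecture.Cruxes.H413.K2E1OnePlusSqPowerSymbolUniform
open Summit.HodgeConjecture.HodgeConjecture.Cruxes.H413.K2E1HeightLineArchSmoothU2 (ofReal_inv_prod_mul_cpow norm_ofReal_inv_cpow_mul_prod_rpow_neg norm_proj_comp_fst_le_one)
open Summit.HodgeConjecture.HodgeConjecture.Cruxes.H413.K2E1TensorSymbolProduct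
open Summit.HodgeConjecture.HodgeConjecture.Cruxes.H413.K2E1HeightLineArchSmoothU3
open Summit.HodgeConjecture.HodgeConjecture.Cruxes.H413.K2E1SymbolFaaDiBruno (norm_iteratedFDeriv_cpow_neg_le_of_symbol)
-- `Classical` is needed to see the Mathlib normed-space instances on `mixedSpace` (note H5 of `AdelicGLnGlue`)
open scoped NNReal ContDiff Classical

namespace Summit.HodgeConjecture.HodgeConjecture.Cruxes.H413.K2E1HeightLineArchSmoothUniformU3

/-! ## §1 The affine symbol `f(s) = A + c s²` has `‖Dⁱ f‖ ≤ K·f`, `K = √c₀ + 2c₀`, for all `A ≥ 1`, `0 < c ≤ c₀`, `i ≥ 1` -/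

section Affine

/-- The derivatives of `s ↦ A + c s²`: `Dⁱ = c·(2)_i·s^{2−i}` (falling factorial; `0` for `i ≥ 3`). [folklore] -/
theorem iteratedDeriv_affine (A c : ℝ) {i : ℕ} (hi : 0 < i) (s : ℝ) :
    iteratedDeriv i (fun u : ℝ => A + c * u ^ 2) s = c * ((Nat.descFactorial 2 i : ℝ) * s ^ (2 - i)) := by
  rw [iteratedDeriv_const_add hi A, iteratedDeriv_const_mul_field, iteratedDeriv_pow]

/-- **`‖Dⁱ(A + c s²)‖ ≤ (√c₀ + 2c₀)·(A + c s²)`** for `i ≥ 1`, `A ≥ 1`, `0 < c ≤ c₀` (AM–GM `2c|s| ≤ √c(1 + cs²)`; `2c ≤ 2c₀·f`; higher derivatives vanish). [cite: HormanderALPDO1, §7.1] -/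
theorem norm_iteratedFDeriv_affine_le_mul {A c c₀ : ℝ} (hA : 1 ≤ A) (hc : 0 < c) (hcc₀ : c ≤ c₀) {i : ℕ} (hi : 1 ≤ i) (s : ℝ) :
    ‖iteratedFDeriv ℝ i (fun u : ℝ => A + c * u ^ 2) s‖ ≤ (Real.sqrt c₀ + 2 * c₀) * (A + c * s ^ 2) := by
  have hc₀ : 0 < c₀ := hc.trans_le hcc₀
  have hf1 : 1 ≤ A + c * s ^ 2 := hA.trans (le_add_of_nonneg_right (by positivity))
  have hf0 : 0 ≤ A + c * s ^ 2 := zero_le_one.trans hf1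
  have hsc : Real.sqrt c ≤ Real.sqrt c₀ := Real.sqrt_le_sqrt hcc₀
  have hsc0 : 0 ≤ Real.sqrt c := Real.sqrt_nonneg _
  rw [norm_iteratedFDeriv_eq_norm_iteratedDeriv, iteratedDeriv_affine A c hi s]
  rcases Nat.lt_or_ge i 3 with hlt | hge
  · interval_cases i
    · -- `i = 1`: `‖2 c s‖ ≤ √c·(1 + c s²) ≤ √c₀·f ≤ K·f`
      have h2 : (Nat.descFactorial 2 1 : ℝ) = 2 := by norm_num [Nat.descFactorial]
      rw [h2, show (2 : ℕ) - 1 = 1 from rfl, pow_one, Real.norm_eq_abs, abs_mul, abs_mul, abs_of_pos hc, abs_two]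
      have key : c * (2 * |s|) ≤ Real.sqrt c * (1 + c * s ^ 2) := by
        have ht : c * s ^ 2 = (Real.sqrt c * |s|) ^ 2 := by rw [mul_pow, Real.sq_sqrt hc.le, sq_abs]
        have h2 : c * (2 * |s|) = Real.sqrt c * (2 * (Real.sqrt c * |s|)) := by
          rw [show Real.sqrt c * (2 * (Real.sqrt c * |s|)) = (Real.sqrt c * Real.sqrt c) * (2 * |s|) by ring, Real.mul_self_sqrt hc.le]
        rw [ht, h2]
        exact mul_le_mul_of_nonneg_left (by nlinarith [sq_nonneg (Real.sqrt c * |s| - 1)]) hsc0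
      calc c * (2 * |s|) ≤ Real.sqrt c * (1 + c * s ^ 2) := key
        _ ≤ Real.sqrt c₀ * (A + c * s ^ 2) := mul_le_mul hsc (by linarith) (zero_le_one.trans (by linarith [mul_nonneg hc.le (sq_nonneg s)])) (Real.sqrt_nonneg _)
        _ ≤ (Real.sqrt c₀ + 2 * c₀) * (A + c * s ^ 2) := mul_le_mul_of_nonneg_right (le_add_of_nonneg_right (by positivity)) hf0
    · -- `i = 2`: `‖2 c‖ ≤ 2c₀ ≤ 2c₀·f ≤ K·f`
      have h2 : (Nat.descFactorial 2 2 : ℝ) = 2 := by norm_num [Nat.descFactorial]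
      rw [h2, show (2 : ℕ) - 2 = 0 from rfl, pow_zero, mul_one, Real.norm_eq_abs, abs_mul, abs_of_pos hc, abs_two]
      calc c * 2 ≤ 2 * c₀ * 1 := by linarith
        _ ≤ 2 * c₀ * (A + c * s ^ 2) := mul_le_mul_of_nonneg_left hf1 (by positivity)
        _ ≤ (Real.sqrt c₀ + 2 * c₀) * (A + c * s ^ 2) := mul_le_mul_of_nonneg_right (le_add_of_nonneg_left (Real.sqrt_nonneg _)) hf0
  · -- `i ≥ 3`: the derivative vanishes
    rw [(Nat.descFactorial_eq_zero_iff_lt.2 (by omega) : Nat.descFactorial 2 i = 0)]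
    simp only [Nat.cast_zero, zero_mul, mul_zero, norm_zero]
    positivity

end Affine

/-! ## §2 The affine symbol estimate, UNIFORM on `‖z‖ ≤ R` (and in `A ≥ 1`, `0 < c ≤ c₀`) -/

section Uniform

/-- **`‖Dⁿ[(A + c s²)^{−z}](s)‖ ≤ C·(A + c s²)^{−Re z}` with ONE `C = C(c₀, R, n)` for ALL `‖z‖ ≤ R`, `A ≥ 1`, `0 < c ≤ c₀`, `s`** — ★ (E-a) `norm_iteratedFDeriv_cpow_neg_le_of_symbol` with §1's
`K = √c₀ + 2c₀`, its constant `Σ_c (∏_{l<|c|}(‖z‖ + l))·K^{|c|}` bounded by the same sum at `R`.  The `z`-UNIFORM form of ★ (a1ᵘ) `exists_norm_iteratedDeriv_affine_le_uniform`.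
[cite: HormanderALPDO1, §7.1] [cite: MoeglinWaldspurger1995, I.2.10–I.2.12] -/
theorem exists_norm_iteratedDeriv_affine_le_uniform_of_norm_le {c₀ : ℝ} (hc₀ : 0 < c₀) (R : ℝ) (n : ℕ) :
    ∃ C : ℝ, 0 ≤ C ∧ ∀ z : ℂ, ‖z‖ ≤ R → ∀ A : ℝ, 1 ≤ A → ∀ c : ℝ, 0 < c → c ≤ c₀ → ∀ s : ℝ,
      ‖iteratedDeriv n (fun s : ℝ => ((((A + c * s ^ 2 : ℝ)) : ℂ) ^ (-z))) s‖ ≤ C * (A + c * s ^ 2) ^ (-z.re) := by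
  set K : ℝ := Real.sqrt c₀ + 2 * c₀ with hK
  have hK0 : 0 ≤ K := by positivity
  have hR : ∀ z : ℂ, ‖z‖ ≤ R → 0 ≤ R := fun z hz => (norm_nonneg z).trans hz
  refine ⟨∑ p : OrderedFinpartition n, (∏ l ∈ Finset.range p.length, (max R 0 + l)) * K ^ p.length,
    Finset.sum_nonneg fun p _ => mul_nonneg (Finset.prod_nonneg fun l _ => by positivity) (pow_nonneg hK0 _), fun z hz A hA c hc hcc₀ s => ?_⟩
  have hf : ContDiff ℝ n (fun u : ℝ => A + c * u ^ 2) := contDiff_const.add (contDiff_const.mul (contDiff_id.pow 2))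
  have hf1 : ∀ u : ℝ, 1 ≤ A + c * u ^ 2 := fun u => hA.trans (le_add_of_nonneg_right (by positivity))
  have h := norm_iteratedFDeriv_cpow_neg_le_of_symbol n z hf hf1 (x := s) fun i hi _ => norm_iteratedFDeriv_affine_le_mul hA hc hcc₀ hi s
  rw [norm_iteratedFDeriv_eq_norm_iteratedDeriv] at h
  refine h.trans (mul_le_mul_of_nonneg_right (Finset.sum_le_sum fun p _ => mul_le_mul_of_nonneg_right
    (Finset.prod_le_prod (fun l _ => by positivity) fun l _ => by linarith [le_max_left R 0, le_max_right R 0, hz]) (pow_nonneg hK0 _))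
    (Real.rpow_nonneg (zero_le_one.trans (hf1 s)) _))

end Uniform

/-! ## §3 The centre-layer binder `hφarch`, ONE `C_φ` for all `‖z‖ ≤ R` -/

section ArchSmooth

variable (L : Type) [Field L] [NumberField L] [IsCMField L]

/-- **(q11) «Kc-UNIFORM ARCH» — THE ARCHIMEDEAN SMOOTHNESS BINDER `hφarch` OF ★ p857895 FOR `φ ≡ φ₀`, UNIFORMLY IN `z` ON `‖z‖ ≤ R`.**  For a CM field `L`, `δ ∈ L⁻ ∖ 0`, `φ₀ ∈ ℂ`,
`m ∈ ℕ`, `R ∈ ℝ` there is ONE `C_φ ≥ 0` such that for EVERY `z` with `‖z‖ ≤ R`, every `k ∈ K_U`, every shift `X ∈ 𝔸_L` and every `b ∈ 𝔸_{L⁺}^∞` the function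
`(a ↦ f_z(ι(w₀)·u(X, θ(a, b))·k)) ∘ ι⁻¹` on `mixedSpace L⁺` is `C^m` with `‖Dʲ(…)(s)‖ ≤ C_φ·H(ι(w₀)·u(X, θ(ι⁻¹ s, b))·k)^{Re z}` (`j ≤ m`) — ★ (a3)₃
`exists_archSmooth_flatSectionU_const_cm_three` with `∃ C_φ` hoisted before `z` (proof verbatim, the per-place constants from §2). [cite: MoeglinWaldspurger1995, I.2.10–I.2.12, II.1.5]
[cite: HormanderALPDO1, §7.1] [cite: Garrett2018, §2.2, §12.2] -/
theorem exists_archSmooth_flatSectionU_const_cm_three_uniform (hc : IsCMField.complexConj L * IsCMField.complexConj L = 1) {δ : L} (hcδ : IsCMField.complexConj L δ = -δ) (hδ : δ ≠ 0)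
    (φ₀ : ℂ) (m : ℕ) (R : ℝ) :
    ∃ Cφ : ℝ, 0 ≤ Cφ ∧ ∀ z : ℂ, ‖z‖ ≤ R →
    ∀ k ∈ (((standardMaximalCompactGL 3 L).comap (adelicVal ↥(maximalRealSubfield L) L (IsCMField.complexConj L) 3 ((StdForm.antidiagonal 3).over L)) : Subgroup (quasiSplit (↥(maximalRealSubfield L)) L (IsCMField.complexConj L) 3).Adelic) : Set (quasiSplit (↥(maximalRealSubfield L)) L (IsCMField.complexConj L) 3).Adelic), ∀ (X : AdeleRing (𝓞 L) L) (b : FiniteAdeleRing (𝓞 ↥(maximalRealSubfield L)) ↥(maximalRealSubfield L)),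
      ContDiff ℝ m ((fun a : InfiniteAdeleRing ↥(maximalRealSubfield L) => flatSectionU (fun _ : (quasiSplit (↥(maximalRealSubfield L)) L (IsCMField.complexConj L) 3).Adelic => φ₀) z (((quasiSplit (↥(maximalRealSubfield L)) L (IsCMField.complexConj L) 3).toAdelic (weylLongU ((IsCMField.complexConj L : L ≃ₐ[↥(maximalRealSubfield L)] L) : L →+* L) (rfl : ((StdForm.antidiagonal 3).over L) = ((StdForm.antidiagonal 3).over L)))) * ((heisChart hc (X, traceZeroLine ↥(maximalRealSubfield L) L (IsCMField.complexConj L) hcδ hδ ((a, b) : AdeleRing (𝓞 ↥(maximalRealSubfield L)) ↥(maximalRealSubfield L))) : ↥(adelicUnipotent ↥(maximalRealSubfield L) L (IsCMField.complexConj L) 3)) : (quasiSplit (↥(maximalRealSubfield L)) L (IsCMField.complexConj L) 3).Adelic) * k)) ∘ (InfiniteAdeleRing.ringEquiv_mixedSpace ↥(maximalRealSubfield L)).symm) ∧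
      ∀ j : ℕ, j ≤ m → ∀ s : mixedSpace ↥(maximalRealSubfield L),
        ‖iteratedFDeriv ℝ j ((fun a : InfiniteAdeleRing ↥(maximalRealSubfield L) => flatSectionU (fun _ : (quasiSplit (↥(maximalRealSubfield L)) L (IsCMField.complexConj L) 3).Adelic => φ₀) z (((quasiSplit (↥(maximalRealSubfield L)) L (IsCMField.complexConj L) 3).toAdelic (weylLongU ((IsCMField.complexConj L : L ≃ₐ[↥(maximalRealSubfield L)] L) : L →+* L) (rfl : ((StdForm.antidiagonal 3).over L) = ((StdForm.antidiagonal 3).over L)))) * ((heisChart hc (X, traceZeroLine ↥(maximalRealSubfield L) L (IsCMField.complexConj L) hcδ hδ ((a, b) : AdeleRing (𝓞 ↥(maximalRealSubfield L)) ↥(maximalRealSubfield L))) : ↥(adelicUnipotent ↥(maximalRealSubfield L) L (IsCMField.complexConj L) 3)) : (quasiSplit (↥(maximalRealSubfield L)) L (IsCMField.complexConj L) 3).Adelic) * k)) ∘ (InfiniteAdeleRing.ringEquiv_mixedSpace ↥(maximalRealSubfield L)).symm) s‖ ≤ Cφ * (borelHeight (((quasiSplit (↥(maximalRealSubfield L))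 L (IsCMField.complexConj L) 3).toAdelic (weylLongU ((IsCMField.complexConj L : L ≃ₐ[↥(maximalRealSubfield L)] L) : L →+* L) (rfl : ((StdForm.antidiagonal 3).over L) = ((StdForm.antidiagonal 3).over L)))) * ((heisChart hc (X, traceZeroLine ↥(maximalRealSubfield L) L (IsCMField.complexConj L) hcδ hδ ((((InfiniteAdeleRing.ringEquiv_mixedSpace ↥(maximalRealSubfield L)).symm s), b) : AdeleRing (𝓞 ↥(maximalRealSubfield L)) ↥(maximalRealSubfield L))) : ↥(adelicUnipotent ↥(maximalRealSubfield L) L (IsCMField.complexConj L) 3)) : (quasiSplit (↥(maximalRealSubfield L)) L (IsCMField.complexConj L) 3).Adelic) * k) : ℝ) ^ z.re := by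
  -- (0) place data independent of `k`, `X`, `b`: curvatures `c_w = (w δ)² > 0`, coordinate forms `ℓ_w`, the affine-uniform constants of ★ (a1ᵘ)
  set c : InfinitePlace L → ℝ := fun w => (w δ) ^ 2 with hc_def
  have hcpos : ∀ w, 0 < c w := fun w => K2E1HeightBigCellLineFormulaU2.sq_apply_pos_of_ne_zero L hδ w
  set ℓ : InfinitePlace L → (mixedSpace ↥(maximalRealSubfield L) →L[ℝ] ℝ) := fun w =>
    (ContinuousLinearMap.proj (R := ℝ) (φ := fun _ : {v : InfinitePlace ↥(maximalRealSubfield L) // v.IsReal} => ℝ) ⟨w.comap (algebraMap ↥(maximalRealSubfield L) L), K2E1HeightBigCellLineFormulaU2.isReal_comap_maximalRealSubfield L w⟩).comp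
      (ContinuousLinearMap.fst ℝ ({v : InfinitePlace ↥(maximalRealSubfield L) // v.IsReal} → ℝ) ({v : InfinitePlace ↥(maximalRealSubfield L) // v.IsComplex} → ℂ)) with hℓ_def
  have hℓ : ∀ w, ‖ℓ w‖ ≤ 1 := fun w => norm_proj_comp_fst_le_one ↥(maximalRealSubfield L) _
  choose C hC0 hC using fun w : InfinitePlace L => fun j : ℕ => exists_norm_iteratedDeriv_affine_le_uniform_of_norm_le (hcpos w) R j
  set Cmax : ℝ := ∑ w : InfinitePlace L, ∑ j ∈ Finset.range (m + 1), C w j with hCmax_def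
  have hCmax0 : 0 ≤ Cmax := Finset.sum_nonneg fun w _ => Finset.sum_nonneg fun j _ => hC0 w j
  have hCle : ∀ w, ∀ j ≤ m, C w j ≤ Cmax := by
    intro w j hj
    calc C w j ≤ ∑ j ∈ Finset.range (m + 1), C w j :=
          Finset.single_le_sum (f := fun j => C w j) (fun i _ => hC0 w i) (Finset.mem_range.2 (Nat.lt_succ_of_le hj))
      _ ≤ Cmax := Finset.single_le_sum (f := fun w => ∑ j ∈ Finset.range (m + 1), C w j) (fun w _ => Finset.sum_nonneg fun j _ => hC0 w j) (Finset.mem_univ w)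
  refine ⟨‖φ₀‖ * (2 ^ m * Cmax) ^ (Finset.univ : Finset (InfinitePlace L)).card, by positivity, fun z hzR k hk X b => ?_⟩
  -- (1) the shift `X` enters only through `A_w = (1 + ½‖X_w‖²)² ≥ 1`
  set A : InfinitePlace L → ℝ := fun w => (1 + ‖X.1 w‖ ^ 2 / 2) ^ 2 with hA_def
  have hA1 : ∀ w, 1 ≤ A w := fun w => one_le_sq_one_add_half_norm_sq L X w
  have hA0 : ∀ w, 0 < A w := fun w => zero_lt_one.trans_le (hA1 w)
  set Fw : InfinitePlace L → ℝ → ℂ := fun w u => ((((A w + c w * u ^ 2 : ℝ)) : ℂ) ^ (-z)) with hFw_def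
  have hF : ∀ w, ContDiff ℝ (m : ℕ∞) (Fw w) := fun w => contDiff_affinePow (hA0 w) (hcpos w).le z
  set g : InfinitePlace L → mixedSpace ↥(maximalRealSubfield L) → ℂ := fun w => Fw w ∘ ℓ w with hg_def
  have hg : ∀ w ∈ (Finset.univ : Finset (InfinitePlace L)), ContDiff ℝ (m : ℕ∞) (g w) := fun w _ => (hF w).comp (ℓ w).contDiff
  set e : InfinitePlace L → mixedSpace ↥(maximalRealSubfield L) → ℝ := fun w s => (A w + c w * (ℓ w s) ^ 2) ^ (-z.re) with he_def
  have he : ∀ w ∈ (Finset.univ : Finset (InfinitePlace L)), ∀ s, 0 ≤ e w s := fun w _ s => Real.rpow_nonneg (affine_pos (hA0 w) (hcpos w).le _).le _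
  have hb : ∀ w ∈ (Finset.univ : Finset (InfinitePlace L)), ∀ j ≤ m, ∀ s, ‖iteratedFDeriv ℝ j (g w) s‖ ≤ Cmax * e w s := by
    intro w _ j hj s
    have hjm : (j : WithTop ℕ∞) ≤ (m : ℕ∞) := by exact_mod_cast hj
    calc ‖iteratedFDeriv ℝ j (g w) s‖ ≤ ‖iteratedDeriv j (Fw w) (ℓ w s)‖ := norm_iteratedFDeriv_comp_form_le (hF w) (ℓ w) (hℓ w) s hjm
      _ ≤ C w j * (A w + c w * (ℓ w s) ^ 2) ^ (-z.re) := hC w j z hzR (A w) (hA1 w) (c w) (hcpos w) le_rfl (ℓ w s)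
      _ ≤ Cmax * e w s := mul_le_mul_of_nonneg_right (hCle w j hj) (he w (Finset.mem_univ w) s)
  -- (2) the tensor Leibniz rule with the `X`-independent constant `(2ᵐ C_max)^{#places}`
  obtain ⟨hprod, hbound⟩ := norm_iteratedFDeriv_finset_prod_le_explicit (Finset.univ : Finset (InfinitePlace L)) hg (le_refl _) hCmax0 he hb
  -- (3) the finite factor and the closed form (§2)
  have hhf0 : 0 < ((∏ᶠ v : HeightOneSpectrum (𝓞 L), max 1 (max ‖X.2 v‖₊ ‖(heisZ (c := IsCMField.complexConj L) X ((traceZeroLine ↥(maximalRealSubfield L) L (IsCMField.complexConj L) hcδ hδ ((0, b) : AdeleRing (𝓞 ↥(maximalRealSubfield L)) ↥(maximalRealSubfield L)) : traceZeroAdele ↥(maximalRealSubfield L) L (IsCMField.complexConj L)) : AdeleRing (𝓞 L) L)).2 v‖₊) : ℝ≥0) : ℝ) := zero_lt_one.trans_le (one_le_coe_finprod_heisZ_line_cm_three L hcδ hδ X b)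
  have hfun : ((fun a : InfiniteAdeleRing ↥(maximalRealSubfield L) => flatSectionU (fun _ : (quasiSplit (↥(maximalRealSubfield L)) L (IsCMField.complexConj L) 3).Adelic => φ₀) z (((quasiSplit (↥(maximalRealSubfield L)) L (IsCMField.complexConj L) 3).toAdelic (weylLongU ((IsCMField.complexConj L : L ≃ₐ[↥(maximalRealSubfield L)] L) : L →+* L) (rfl : ((StdForm.antidiagonal 3).over L) = ((StdForm.antidiagonal 3).over L)))) * ((heisChart hc (X, traceZeroLine ↥(maximalRealSubfield L) L (IsCMField.complexConj L) hcδ hδ ((a, b) : AdeleRing (𝓞 ↥(maximalRealSubfield L)) ↥(maximalRealSubfield L))) : ↥(adelicUnipotent ↥(maximalRealSubfield L) L (IsCMField.complexConj L) 3)) : (quasiSplit (↥(maximalRealSubfield L)) L (IsCMField.complexConj L) 3).Adelic) * k)) ∘ (InfiniteAdeleRing.ringEquiv_mixedSpace ↥(maximalRealSubfield L)).symm) = (φ₀ * (((((∏ᶠ v : HeightOneSpectrum (𝓞 L), max 1 (max ‖X.2 v‖₊ ‖(heisZ (c := IsCMField.complexConj L) X ((traceZeroLine ↥(maximalRealSubfield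 L) L (IsCMField.complexConj L) hcδ hδ ((0, b) : AdeleRing (𝓞 ↥(maximalRealSubfield L)) ↥(maximalRealSubfield L)) : traceZeroAdele ↥(maximalRealSubfield L) L (IsCMField.complexConj L)) : AdeleRing (𝓞 L) L)).2 v‖₊) : ℝ≥0) : ℝ))⁻¹ : ℝ) : ℂ) ^ z) • fun s => ∏ w, g w s := by
    funext s
    rw [flatSectionU_const_heisChart_line_apply_cm_three L hc hcδ hδ z φ₀ hk X b s, Pi.smul_apply, smul_eq_mul, mul_assoc]
    rfl
  have hcd : ContDiff ℝ m ((φ₀ * (((((∏ᶠ v : HeightOneSpectrum (𝓞 L), max 1 (max ‖X.2 v‖₊ ‖(heisZ (c := IsCMField.complexConj L) X ((traceZeroLine ↥(maximalRealSubfield L) L (IsCMField.complexConj L) hcδ hδ ((0, b) : AdeleRing (𝓞 ↥(maximalRealSubfield L)) ↥(maximalRealSubfield L)) : traceZeroAdele ↥(maximalRealSubfield L) L (IsCMField.complexConj L)) : AdeleRing (𝓞 L) L)).2 v‖₊) : ℝ≥0) : ℝ))⁻¹ : ℝ) : ℂ) ^ z) • fun s => ∏ w, g w s) := hprod.const_smul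 (φ₀ * (((((∏ᶠ v : HeightOneSpectrum (𝓞 L), max 1 (max ‖X.2 v‖₊ ‖(heisZ (c := IsCMField.complexConj L) X ((traceZeroLine ↥(maximalRealSubfield L) L (IsCMField.complexConj L) hcδ hδ ((0, b) : AdeleRing (𝓞 ↥(maximalRealSubfield L)) ↥(maximalRealSubfield L)) : traceZeroAdele ↥(maximalRealSubfield L) L (IsCMField.complexConj L)) : AdeleRing (𝓞 L) L)).2 v‖₊) : ℝ≥0) : ℝ))⁻¹ : ℝ) : ℂ) ^ z)
  refine ⟨by rw [hfun]; exact hcd, fun j hj s => ?_⟩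
  rw [hfun, iteratedFDeriv_const_smul_apply ((hprod.of_le (by exact_mod_cast hj)).contDiffAt), _root_.norm_smul]
  -- (4) `‖φ₀‖·h_f^{−Re z}·(2ᵐC_max)^# · ∏_w (A_w + c_w s_w²)^{−Re z} = C_φ · H^{Re z}`
  have hA : ‖(φ₀ * (((((∏ᶠ v : HeightOneSpectrum (𝓞 L), max 1 (max ‖X.2 v‖₊ ‖(heisZ (c := IsCMField.complexConj L) X ((traceZeroLine ↥(maximalRealSubfield L) L (IsCMField.complexConj L) hcδ hδ ((0, b) : AdeleRing (𝓞 ↥(maximalRealSubfield L)) ↥(maximalRealSubfield L)) : traceZeroAdele ↥(maximalRealSubfield L) L (IsCMField.complexConj L)) : AdeleRing (𝓞 L) L)).2 v‖₊) : ℝ≥0) : ℝ))⁻¹ : ℝ) : ℂ) ^ z)‖ = ‖φ₀‖ * ‖(((((∏ᶠ v : HeightOneSpectrum (𝓞 L), max 1 (max ‖X.2 v‖₊ ‖(heisZ (c := IsCMField.complexConj L) X ((traceZeroLine ↥(maximalRealSubfield L) L (IsCMField.complexConj L) hcδ hδ ((0, b) : AdeleRing (𝓞 ↥(maximalRealSubfield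 L)) ↥(maximalRealSubfield L)) : traceZeroAdele ↥(maximalRealSubfield L) L (IsCMField.complexConj L)) : AdeleRing (𝓞 L) L)).2 v‖₊) : ℝ≥0) : ℝ))⁻¹ : ℝ) : ℂ) ^ z‖ := norm_mul _ _
  have hH : ‖(((((∏ᶠ v : HeightOneSpectrum (𝓞 L), max 1 (max ‖X.2 v‖₊ ‖(heisZ (c := IsCMField.complexConj L) X ((traceZeroLine ↥(maximalRealSubfield L) L (IsCMField.complexConj L) hcδ hδ ((0, b) : AdeleRing (𝓞 ↥(maximalRealSubfield L)) ↥(maximalRealSubfield L)) : traceZeroAdele ↥(maximalRealSubfield L) L (IsCMField.complexConj L)) : AdeleRing (𝓞 L) L)).2 v‖₊) : ℝ≥0) : ℝ))⁻¹ : ℝ) : ℂ) ^ z‖ * ∏ w, e w s = (borelHeight (((quasiSplit (↥(maximalRealSubfield L)) L (IsCMField.complexConj L) 3).toAdelic (weylLongU ((IsCMField.complexConj L : L ≃ₐ[↥(maximalRealSubfield L)] L) : L →+* L) (rfl : ((StdForm.antidiagonal 3).over L) = ((StdForm.antidiagonal 3).over L)))) * ((heisChart hc (X, traceZeroLine ↥(maximalRealSubfield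 L) L (IsCMField.complexConj L) hcδ hδ ((((InfiniteAdeleRing.ringEquiv_mixedSpace ↥(maximalRealSubfield L)).symm s), b) : AdeleRing (𝓞 ↥(maximalRealSubfield L)) ↥(maximalRealSubfield L))) : ↥(adelicUnipotent ↥(maximalRealSubfield L) L (IsCMField.complexConj L) 3)) : (quasiSplit (↥(maximalRealSubfield L)) L (IsCMField.complexConj L) 3).Adelic) * k) : ℝ) ^ z.re := by
    rw [coe_borelHeight_weylLongU_heisChart_line_mul_eq_cm_three L hc hcδ hδ hk X b s,
      ← norm_ofReal_inv_cpow_mul_prod_rpow_neg Finset.univ (fun w _ => (affine_pos (hA0 w) (hcpos w).le _).le) hhf0 z]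
    rfl
  calc ‖(φ₀ * (((((∏ᶠ v : HeightOneSpectrum (𝓞 L), max 1 (max ‖X.2 v‖₊ ‖(heisZ (c := IsCMField.complexConj L) X ((traceZeroLine ↥(maximalRealSubfield L) L (IsCMField.complexConj L) hcδ hδ ((0, b) : AdeleRing (𝓞 ↥(maximalRealSubfield L)) ↥(maximalRealSubfield L)) : traceZeroAdele ↥(maximalRealSubfield L) L (IsCMField.complexConj L)) : AdeleRing (𝓞 L) L)).2 v‖₊) : ℝ≥0) : ℝ))⁻¹ : ℝ) : ℂ) ^ z)‖ * ‖iteratedFDeriv ℝ j (fun s => ∏ w, g w s) s‖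
        ≤ ‖(φ₀ * (((((∏ᶠ v : HeightOneSpectrum (𝓞 L), max 1 (max ‖X.2 v‖₊ ‖(heisZ (c := IsCMField.complexConj L) X ((traceZeroLine ↥(maximalRealSubfield L) L (IsCMField.complexConj L) hcδ hδ ((0, b) : AdeleRing (𝓞 ↥(maximalRealSubfield L)) ↥(maximalRealSubfield L)) : traceZeroAdele ↥(maximalRealSubfield L) L (IsCMField.complexConj L)) : AdeleRing (𝓞 L) L)).2 v‖₊) : ℝ≥0) : ℝ))⁻¹ : ℝ) : ℂ) ^ z)‖ * ((2 ^ m * Cmax) ^ (Finset.univ : Finset (InfinitePlace L)).card * ∏ w, e w s) := mul_le_mul_of_nonneg_left (hbound j hj s) (norm_nonneg _)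
    _ = ‖φ₀‖ * (2 ^ m * Cmax) ^ (Finset.univ : Finset (InfinitePlace L)).card * (‖(((((∏ᶠ v : HeightOneSpectrum (𝓞 L), max 1 (max ‖X.2 v‖₊ ‖(heisZ (c := IsCMField.complexConj L) X ((traceZeroLine ↥(maximalRealSubfield L) L (IsCMField.complexConj L) hcδ hδ ((0, b) : AdeleRing (𝓞 ↥(maximalRealSubfield L)) ↥(maximalRealSubfield L)) : traceZeroAdele ↥(maximalRealSubfield L) L (IsCMField.complexConj L)) : AdeleRing (𝓞 L) L)).2 v‖₊) : ℝ≥0) : ℝ))⁻¹ : ℝ) : ℂ) ^ z‖ * ∏ w, e w s) := by rw [hA]; ring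
    _ = _ := by rw [hH]


end ArchSmooth

end Summit.HodgeConjecture.HodgeConjecture.Cruxes.H413.K2E1HeightLineArchSmoothUniformU3

end
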